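import Summits.CriticalPhenomena.CardyFormulaZ2.Theorems.DyadicBetaRigidityDyadicBetaSuffices

/-!
# Stub S2 `stub_subseqSandwich` of line `Sketch` (crux `DyadicLatticeBetaLaw`,
# stmt-CriticalPhenomena-18183, route DyadicBetaRigidity of `CardyFormulaZ2`)

The SEQUENTIAL form of the landed glue `DyadicLattice.hasCrossingLimit_of_dyadicLattice`
(`Theorems/DyadicBetaRigidityDyadicBetaSuffices.lean`). Along a strictly increasing `κ : ℕ → ℕ`,
if every lattice polygon `P` of every mesh `h` has bond-`ℤ²` crossing probabilities converging
along the shifted ladders `h 2^j / 2^(κ n)` to `f(η_P)`, `f` continuous on `(0, 1)`, then EVERY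
conformal rectangle `R` satisfies along the meshes `1/2^(κ n)`, for every `e > 0`, eventually the
lower bound `f(η_R) - e < P[R]` and the upper bound `P[R] < 1 - f(1 - η_R) + e` (no symmetry of
`f` is assumed).

Proof: the two halves `hlow` / `hup` of the landed proof (Bollobás–Riordan's sandwich: lower
comparison quad + lattice-polygon approximant with the same marks + near-trivial dilates + exact
dilation covariance; upper bound by bond self-duality for the cyclically re-marked copy of modulus
`1 - η_R`), with a simpler SEQUENTIAL MESH ARITHMETIC (`eventually_lt_of_dilates_seq`): for the
approximant `P` at mesh `d` choose ONE shift `j` with `d 2^j ≥ max (1, 1/θ)`, put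
`N := ⌊d 2^j⌋₊`, `c := N / (d 2^j) ∈ (1 - θ, 1]`; then `c · (d/N) 2^j / 2^(κ n) = 1/2^(κ n)` for
every `n`, so `P[cP, 1/2^(κ n)] = P[P, (d/N) 2^j / 2^(κ n)] → f(η_P)` by the hypothesis applied to
the `(d/N)`-lattice polygon `P` (`latticePolygon_refine`) and exact dilation covariance
(`bondDomainCrossingProb_dilate`).

References: B. Bollobás, O. Riordan, *Percolation* (2006), Ch. 7 Lemma 14, Claims 19–20, remark
p. 195; S. Smirnov, C. R. Acad. Sci. Paris 333 (2001), §2.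
-/

noncomputable section
open MeasureTheory Filter Set Metric Topology
open UpperHalfPlane (upperHalfPlaneSet)
open Literature.Probability.RandomPlanarGeometry Literature.Probability.LatticeModels
open Literature.Probability.Percolation hiding cardyFunction
namespace Summit.CriticalPhenomena.CardyFormulaZ2.Cruxes.DyadicLatticeBetaLaw.Stubs

open Summit.CriticalPhenomena.CardyFormulaZ2.Theorems.DyadicLattice
open Summit.CriticalPhenomena.CardyFormulaZ2.Cruxes.LoopsToCrossings.OracleSandwich
  (stub_discreteCrossing_of_pathIn stub_not_discreteCrossing_of_dualPathIn stub_comparisonGeometry)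
open Summit.CriticalPhenomena.CardyFormulaZ2.Theorems.RectilinearApproximation
  (discreteCrossing_subset_of_lower discreteCrossing_subset_plate bond_le_one_sub_real_openCrossing)

/-! ### Sequential mesh arithmetic -/

/-- **The shifted-ladder limits of one lattice polygon control the meshes `1/2^(κ n)`.** Let `P`
be a conformal rectangle whose frontier is covered by edges of `dℤ²`, with uniformizing datum
`(ψ, y)`, and suppose the shifted-ladder hypothesis `hD` (crossing limits `F(η)` along
`h 2^j / 2^(κ n)` for every lattice polygon at every mesh `h` and every shift `j`). If a quantity
`g δ` dominates the crossing probability at mesh `δ` of EVERY dilate `cP`, `c ∈ (0, 1]`, whose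
loop is pointwise `ρ`-close to that of `P` (`0 < δ < δ₂`), then `F(η_P) - e < g (1/2^(κ n))`
eventually: with `N := ⌊d 2^j⌋₊` for one large shift `j` and `c := N/(d 2^j) ≈ 1`, `P` is a
`(d/N)`-lattice polygon (`latticePolygon_refine`) and
`P[cP, 1/2^(κ n)] = P[P, (d/N) 2^j / 2^(κ n)]` (`bondDomainCrossingProb_dilate`), adapted from
`DyadicLattice.eventually_lt_of_dilates`. -/
theorem eventually_lt_of_dilates_seq {F : ℝ → ℝ} {κ : ℕ → ℕ} (hκ : StrictMono κ)
    (hD : ∀ h : ℝ, 0 < h → ∀ P : ConformalRectangle,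
        (∃ S : Finset (ℂ × ℂ), (∀ p ∈ S, ∃ u v : Site 2, (zdGraph 2).Adj u v ∧
            p.1 = meshPoint h u ∧ p.2 = meshPoint h v) ∧
            frontier P.carrier ⊆ ⋃ p ∈ S, segment ℝ p.1 p.2) →
        ∀ (ψ : ConformalEquiv upperHalfPlaneSet P.carrier) (y : Fin 4 → ℝ), P.IsUniformizing ψ y →
          ∀ j : ℕ, Tendsto (fun n : ℕ => bondDomainCrossingProb P (h * 2 ^ j / 2 ^ (κ n))) atTop
            (𝓝 (F (crossRatio y))))
    (P : ConformalRectangle) {d : ℝ} (hd : 0 < d)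
    (hPS : ∃ S : Finset (ℂ × ℂ),
        (∀ p ∈ S, ∃ u v : Site 2, (zdGraph 2).Adj u v ∧ p.1 = meshPoint d u ∧ p.2 = meshPoint d v) ∧
        frontier P.carrier ⊆ ⋃ p ∈ S, segment ℝ p.1 p.2)
    {ψ : ConformalEquiv upperHalfPlaneSet P.carrier} {y : Fin 4 → ℝ}
    (hψ : P.IsUniformizing ψ y) (g : ℝ → ℝ) {ρ δ₂ : ℝ} (hρ : 0 < ρ) (hδ₂ : 0 < δ₂)
    (hcmp : ∀ (c : ℝ) (hc : 0 < c), c ≤ 1 →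
      (∀ u, dist ((c : ℂ) * P.boundary u) (P.boundary u) ≤ ρ) → ∀ δ : ℝ, 0 < δ → δ < δ₂ →
        bondDomainCrossingProb (P.imageUnivalent (fun z ↦ (c : ℂ) * z)
          (differentiableOn_mul_left _ _) (injOn_mul_left (Complex.ofReal_ne_zero.2 hc.ne') _)) δ ≤
          g δ)
    {e : ℝ} (he : 0 < e) :
    ∀ᶠ n : ℕ in atTop, F (crossRatio y) - e < g (1 / 2 ^ (κ n)) := by
  -- the size of `∂P` and the dilation window `θ`
  obtain ⟨M, hM⟩ : ∃ M : ℝ, ∀ u, ‖P.boundary u‖ ≤ M := by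
    obtain ⟨M, hM⟩ := P.isBounded.closure.exists_norm_le
    exact ⟨M, fun u ↦ hM _ (frontier_subset_closure (P.boundary_mem_frontier u))⟩
  set θ : ℝ := ρ / (max M 0 + 1) with hθ
  have hθ0 : 0 < θ := by rw [hθ]; positivity
  have hθM : θ * max M 0 ≤ ρ := by
    have h1 : θ * (max M 0 + 1) = ρ := by rw [hθ]; field_simp
    nlinarith [le_max_right M 0]
  have hdil : ∀ c : ℝ, 1 - θ < c → c ≤ 1 → ∀ u, dist ((c : ℂ) * P.boundary u) (P.boundary u) ≤ ρ := by
    intro c hc1 hc2 u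
    rw [dist_eq_norm, show (c : ℂ) * P.boundary u - P.boundary u = ((c - 1 : ℝ) : ℂ) * P.boundary u by
      push_cast; ring, norm_mul, Complex.norm_real, Real.norm_eq_abs, abs_of_nonpos (by linarith)]
    calc -(c - 1) * ‖P.boundary u‖ ≤ θ * max M 0 :=
          mul_le_mul (by linarith) ((hM u).trans (le_max_left _ _)) (norm_nonneg _) hθ0.le
      _ ≤ ρ := hθM
  -- one shift `j` with `d 2^j > 1 + 1/θ`, the refinement `N := ⌊d 2^j⌋₊ ≥ 1` and the factor `c`
  obtain ⟨j, hj⟩ := pow_unbounded_of_one_lt ((1 + 1 / θ) / d) (one_lt_two (α := ℝ))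
  have hX : 1 + 1 / θ < d * 2 ^ j := (div_lt_iff₀' hd).1 hj
  have hX1 : 1 < d * 2 ^ j := by linarith [one_div_pos.2 hθ0]
  have hXθ : 1 < θ * (d * 2 ^ j) := (div_lt_iff₀' hθ0).1 (by linarith)
  set N : ℕ := ⌊d * 2 ^ j⌋₊ with hN
  have hN0 : 0 < N := Nat.floor_pos.2 hX1.le
  have hN0r : (0 : ℝ) < N := Nat.cast_pos.2 hN0
  have hNX : (N : ℝ) ≤ d * 2 ^ j := Nat.floor_le (by positivity)
  have hXN : d * 2 ^ j < N + 1 := Nat.lt_floor_add_one _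
  set c : ℝ := N / (d * 2 ^ j) with hc
  have hc0 : 0 < c := div_pos hN0r (by positivity)
  have hc1 : c ≤ 1 := div_le_one_of_le₀ hNX (by positivity)
  have hcθ : 1 - θ < c := by
    rw [hc, lt_div_iff₀ (by positivity)]
    nlinarith
  have hceq : ∀ n : ℕ, c * (d / N * 2 ^ j / 2 ^ (κ n)) = 1 / 2 ^ (κ n) := by
    intro n
    rw [hc]
    field_simp
  -- the shifted-ladder limit of `P` as a `(d/N)`-lattice polygon, and the meshes `1/2^(κ n) → 0`
  have hlim := hD (d / N) (by positivity) P (latticePolygon_refine P hN0 hPS) ψ y hψ j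
  have hmesh : Tendsto (fun n : ℕ => (1 : ℝ) / 2 ^ (κ n)) atTop (𝓝 0) := by
    have h1 : Tendsto (fun n : ℕ => (2 : ℝ) ^ (κ n)) atTop atTop :=
      (tendsto_pow_atTop_atTop_of_one_lt one_lt_two).comp hκ.tendsto_atTop
    exact tendsto_const_nhds.div_atTop h1
  filter_upwards [hlim.eventually (lt_mem_nhds (by linarith : F (crossRatio y) - e < F (crossRatio y))),
    hmesh.eventually (eventually_lt_nhds hδ₂)] with n hn hn₂
  -- the comparison at mesh `1/2^(κ n)` for the dilate `cP`, and exact covariance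
  have hδ : (0 : ℝ) < 1 / 2 ^ (κ n) := by positivity
  have h1 := hcmp c hc0 hc1 (hdil c hcθ hc1) _ hδ hn₂
  have h2 := bondDomainCrossingProb_dilate P hc0 (hd := differentiableOn_mul_left _ _)
    (hi := injOn_mul_left (Complex.ofReal_ne_zero.2 hc0.ne') _) (d / N * 2 ^ j / 2 ^ (κ n))
  rw [hceq n] at h2
  rw [h2] at h1
  exact hn.trans_le h1

/-! ### The subsequential sandwich -/

/-- **STUB S2 — the subsequential Bollobás–Riordan sandwich** (sequential form of the landed glue
`DyadicLattice.hasCrossingLimit_of_dyadicLattice`). If along a strictly increasing `κ : ℕ → ℕ`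
every lattice polygon `P` of every mesh `h` has crossing probabilities converging along the shifted
ladders `h 2^j / 2^(κ n)` (`j : ℕ`) to `f(η_P)`, with `f` continuous on `(0,1)`, then EVERY
conformal rectangle `R` satisfies, along the meshes `1/2^(κ n)`, the lower bound
`f(η_R) - e < P[R]` and the upper bound `P[R] < 1 - f(1 - η_R) + e` eventually, for every `e > 0`:
lower comparison quad (`stub_comparisonGeometry`) + lattice-polygon approximant with the same
marks (`exists_latticePolygon_close_marks`) + near-trivial dilates + exact dilation covariance
(`eventually_lt_of_dilates_seq`, `discreteCrossing_subset_of_lower`); upper bound by bond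
self-duality (`bond_le_one_sub_real_openCrossing`, `discreteCrossing_subset_plate`) for the
cyclically re-marked copy of modulus `1 - η_R` (`exists_cyclicFlip_crossRatio`), whose law value
is controlled by `lawContinuity` at `1 - η_R` (no symmetry of `f` needed).
Bollobás–Riordan 2006, Ch. 7 Claims 19–20 and remark p. 195. -/
theorem stub_subseqSandwich :
    ∀ (κ : ℕ → ℕ) (f : ℝ → ℝ), StrictMono κ → ContinuousOn f (Set.Ioo 0 1) →
      (∀ h : ℝ, 0 < h → ∀ P : ConformalRectangle,
        (∃ S : Finset (ℂ × ℂ), (∀ p ∈ S, ∃ u v : Site 2, (zdGraph 2).Adj u v ∧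
            p.1 = meshPoint h u ∧ p.2 = meshPoint h v) ∧
            frontier P.carrier ⊆ ⋃ p ∈ S, segment ℝ p.1 p.2) →
        ∀ (ψ : ConformalEquiv upperHalfPlaneSet P.carrier) (y : Fin 4 → ℝ), P.IsUniformizing ψ y →
          ∀ j : ℕ, Tendsto (fun n : ℕ => bondDomainCrossingProb P (h * 2 ^ j / 2 ^ (κ n))) atTop
            (𝓝 (f (crossRatio y)))) →
      ∀ (R : ConformalRectangle) (φ : ConformalEquiv upperHalfPlaneSet R.carrier) (x : Fin 4 → ℝ),
        R.IsUniformizing φ x → ∀ e : ℝ, 0 < e →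
          (∀ᶠ n : ℕ in atTop, f (crossRatio x) - e < bondDomainCrossingProb R (1 / 2 ^ (κ n))) ∧
          (∀ᶠ n : ℕ in atTop,
            bondDomainCrossingProb R (1 / 2 ^ (κ n)) < 1 - f (1 - crossRatio x) + e) := by
  intro κ f hκ hf hD R φ x hφ e he
  refine ⟨?_, ?_⟩
  · -- lower bound: lower comparison quad `Q`, lattice-polygon approximant `P`, stub A
    obtain ⟨ε₁, hε₁, h1⟩ := lawContinuity hf R φ x hφ (τ := e / 2) (by positivity)
    obtain ⟨m, hm, hgeo⟩ := stub_comparisonGeometry R (ε₁ / 2) (by positivity)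
    obtain ⟨δ₀, hδ₀, t₀, ht₀, hAfor⟩ := stub_discreteCrossing_of_pathIn R
    obtain ⟨⟨Q, r, hr, hQb, hQm, hL1, hL2, hL3, hL4⟩, -⟩ := hgeo t₀ ht₀
    set ρ : ℝ := min (ε₁ / 4) (r / 4) with hρ
    have hρ0 : 0 < ρ := by rw [hρ]; positivity
    have hρε : ρ ≤ ε₁ / 4 := min_le_left _ _
    have hρr : ρ ≤ r / 4 := min_le_right _ _
    obtain ⟨P, d, hd, hPmark, hPS, hPclose⟩ := exists_latticePolygon_close_marks Q hρ0
    obtain ⟨ψ, y, hψ⟩ := MarkedDomain.exists_isUniformizing_holds P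
    have hFP : |f (crossRatio y) - f (crossRatio x)| ≤ e / 2 := by
      refine h1 P (fun u ↦ ?_) (fun i ↦ ?_) ψ y hψ
      · calc dist (P.boundary u) (R.boundary u)
            ≤ dist (P.boundary u) (Q.boundary u) + dist (Q.boundary u) (R.boundary u) :=
              dist_triangle _ _ _
          _ ≤ ρ + ε₁ / 2 := add_le_add (hPclose u) (hQb u)
          _ ≤ ε₁ := by linarith
      · rw [hPmark i]; exact (hQm i).trans (by linarith)
    have hev := eventually_lt_of_dilates_seq hκ hD P hd hPS hψ (bondDomainCrossingProb R) hρ0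
      (lt_min hδ₀ (lt_min hm (half_pos hr))) (e := e / 2) (fun c hc _ hcl δ hδ hδ₂ ↦ by
        have hclose : ∀ u, dist ((P.imageUnivalent (fun z ↦ (c : ℂ) * z)
            (differentiableOn_mul_left _ _) (injOn_mul_left (Complex.ofReal_ne_zero.2 hc.ne') _)).boundary u)
            (Q.boundary u) ≤ 2 * ρ := fun u ↦ by
          rw [boundary_dilate]
          linarith [dist_triangle ((c : ℂ) * P.boundary u) (P.boundary u) (Q.boundary u), hcl u, hPclose u]
        have hδ₀' : δ < δ₀ := hδ₂.trans_le (min_le_left _ _)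
        have hδm : δ < m := hδ₂.trans_le ((min_le_right _ _).trans (min_le_left _ _))
        have hδr : δ < r / 2 := hδ₂.trans_le ((min_le_right _ _).trans (min_le_right _ _))
        have hincl := discreteCrossing_subset_of_lower R Q _ hAfor hL1 hL2 hL3 hL4 hclose
          (fun i ↦ (mark_dilate P (c : ℂ) i).trans (hPmark i)) (by positivity) (by linarith) hδ hδ₀'
          hδm hδr.le ht₀.le
        rw [bondDomainCrossingProb_eq_measureReal, bondDomainCrossingProb_eq_measureReal]
        exact measureReal_mono hincl) (half_pos he)
    filter_upwards [hev] with n hn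
    have hF' := (abs_sub_le_iff.1 hFP).2
    linarith
  · -- upper bound: cyclically re-marked copy `R₂` (modulus `1 - η`), upper quad `N`, stub B
    obtain ⟨R₂, -, hbd, hmk, hflip⟩ := exists_cyclicFlip_crossRatio R
    obtain ⟨φ₂, x₂, hφ₂⟩ := MarkedDomain.exists_isUniformizing_holds R₂
    have hx₂ : f (1 - crossRatio x) = f (crossRatio x₂) := by rw [hflip φ x φ₂ x₂ hφ hφ₂]
    obtain ⟨ε₂, hε₂, h2⟩ := lawContinuity hf R₂ φ₂ x₂ hφ₂ (τ := e / 2) (by positivity)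
    obtain ⟨m, hm, hgeo⟩ := stub_comparisonGeometry R (ε₂ / 2) (by positivity)
    obtain ⟨δ₀, hδ₀, t₀, ht₀, hBfor⟩ := stub_not_discreteCrossing_of_dualPathIn R m hm
    obtain ⟨-, ⟨N, r, hr, hNb, hNm, hU1, hU2, hU3, hU4, hU5⟩⟩ := hgeo t₀ ht₀
    set ρ : ℝ := min (ε₂ / 4) (r / 8) with hρ
    have hρ0 : 0 < ρ := by rw [hρ]; positivity
    have hρε : ρ ≤ ε₂ / 4 := min_le_left _ _
    have hρr : ρ ≤ r / 8 := min_le_right _ _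
    obtain ⟨P, d, hd, hPmark, hPS, hPclose⟩ := exists_latticePolygon_close_marks N hρ0
    obtain ⟨ψ, y, hψ⟩ := MarkedDomain.exists_isUniformizing_holds P
    have hFP : |f (crossRatio y) - f (crossRatio x₂)| ≤ e / 2 := by
      refine h2 P (fun u ↦ ?_) (fun i ↦ ?_) ψ y hψ
      · rw [hbd u]
        calc dist (P.boundary u) (R.boundary (u + R.mark 1))
            ≤ dist (P.boundary u) (N.boundary u) + dist (N.boundary u) (R.boundary (u + R.mark 1)) :=
              dist_triangle _ _ _
          _ ≤ ρ + ε₂ / 2 := add_le_add (hPclose u) (hNb u)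
          _ ≤ ε₂ := by linarith
      · rw [hPmark i, hmk i]; exact (hNm i).trans (by linarith)
    have hev := eventually_lt_of_dilates_seq hκ hD P hd hPS hψ (fun δ ↦ 1 - bondDomainCrossingProb R δ)
      hρ0 (lt_min hδ₀ (lt_min (by positivity : (0 : ℝ) < m / 3) (by positivity : (0 : ℝ) < r / 4)))
      (e := e / 2) (fun c hc _ hcl δ hδ hδ₂ ↦ by
        have hclose : ∀ u, dist ((P.imageUnivalent (fun z ↦ (c : ℂ) * z)
            (differentiableOn_mul_left _ _) (injOn_mul_left (Complex.ofReal_ne_zero.2 hc.ne') _)).boundary u)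
            (N.boundary u) ≤ 2 * ρ := fun u ↦ by
          rw [boundary_dilate]
          linarith [dist_triangle ((c : ℂ) * P.boundary u) (P.boundary u) (N.boundary u), hcl u, hPclose u]
        have hδ₀' : δ < δ₀ := hδ₂.trans_le (min_le_left _ _)
        have hδm : δ < m / 3 := hδ₂.trans_le ((min_le_right _ _).trans (min_le_left _ _))
        have hδr : δ < r / 4 := hδ₂.trans_le ((min_le_right _ _).trans (min_le_right _ _))
        have hle := bond_le_one_sub_real_openCrossing R hBfor hU1 hU2 hU3 hU4 hU5 hδ hδ₀'
          (by linarith) (by linarith) ht₀.le le_rfl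
        have hincl := discreteCrossing_subset_plate N _ hclose
          (fun i ↦ (mark_dilate P (c : ℂ) i).trans (hPmark i)) (by positivity) (by linarith) hδ hδr.le
        have hle' : bondDomainCrossingProb (P.imageUnivalent (fun z ↦ (c : ℂ) * z)
            (differentiableOn_mul_left _ _) (injOn_mul_left (Complex.ofReal_ne_zero.2 hc.ne') _)) δ ≤
            (bondPercolation (zdGraph 2) half).real
              (openCrossing {x : Site 2 | meshPoint δ x ∈ cthickening (r / 2) N.carrier}
                {x | meshPoint δ x ∈ cthickening (r / 2) (N.arc 0)}
                {x | meshPoint δ x ∈ cthickening (r / 2) (N.arc 2)}) := by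
          rw [bondDomainCrossingProb_eq_measureReal]
          exact measureReal_mono hincl
        show _ ≤ 1 - bondDomainCrossingProb R δ
        linarith) (half_pos he)
    filter_upwards [hev] with n hn
    have hF' := (abs_sub_le_iff.1 hFP).2
    rw [hx₂]
    linarith

end Summit.CriticalPhenomena.CardyFormulaZ2.Cruxes.DyadicLatticeBetaLaw.Stubs

end
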